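import Summits.Ventures.HodgeRepro2.T5BergmanGodement
import Summits.Ventures.HodgeRepro2.T5BergmanIntegrableSharpU11

/-!
# Godement's convolution identity on `H_j = U(1,1)`

`T5BergmanGodement` proved, against Rühl's measure `μ_R` on `SU(1,1)`, that the convolution of two
matrix coefficients of `π_k` is a matrix coefficient. This file transfers the identity to
`U(1,1) = Z · SU(1,1)` through the product formula of `T5U11Product`
(`integral_eq_of_scalar_invariant`): for holomorphic `f, h, f', h' ∈ A_k`, `k ≥ 2`, every Haar measure
`μ_U` of `U(1,1)` and every `g ∈ U(1,1)`,

  `c_U • ∫_{U(1,1)} ⟨π_k(g x⁻¹) f, h⟩_k ⟨π_k(x) f', h'⟩_k dμ_U(x) = ⟨f, h'⟩_k ⟨π_k(g) f', h⟩_k / (k - 1)`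

(`integral_matrixCoeffU_mul_inv_mul`), `c_U = haarScalarFactor (map mulHom (haarCircle ⊗ μ_R)) μ_U > 0`
the normalisation constant of the product formula. The two inputs are the invariance of the
integrand under the centre (`conv_integrand_scalarHom_mul`: the central character `λ^k` of the
coefficient at `g x⁻¹ λ⁻¹` cancels the one at `λ x`) and its integrability on `U(1,1)`, obtained from
the `SU(1,1)` integrability of `x ↦ ⟨π_k(g x⁻¹) f, h⟩_k ⟨π_k(x) f', h'⟩_k` (`integrable_matrixCoeff_mul_inv_mul`:
the conjugate of the product integrated in the Schur relations) by the transfer principle of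
`T5BergmanIntegrableSharpU11`. Specialised: GODEMENT'S IDEMPOTENT RELATION on `U(1,1)`
(`godementU`, `godement_normalizedU`: `d_U · φ_v` with `d_U = c_U (k-1)/⟨v,v⟩_k` is a convolution idempotent
of `L¹(U(1,1), μ_U)`) and its lowest-weight form (`godement_lowestU`). Nothing is claimed about (N).

Blind lane: Mathlib + the HodgeRepro2 prefix only; no sorry; axioms ⊆ {propext, Classical.choice,
Quot.sound}.
-/

namespace Summit.Ventures.HodgeRepro2.T5BergmanGodementU11

open MeasureTheory MeasureTheory.Measure Metric Filter Topology Set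
open T5PoincareDensity T5PoincareMeasure T5SU11Unimodular T5U11Unimodular T5U11Product
  T5SU11Fibration T5SU11FibrationHaar T5SU11FibrationCartan T5HaarCircle T5SU11CoefficientL2
open T5BergmanCoefficient T5BergmanPairing T5BergmanUnitary T5BergmanCoefficientL2 T5BergmanFourier
  T5BergmanParseval T5BergmanProjection T5BergmanActStable T5BergmanMatrixCoeff T5BergmanSchur
  T5BergmanSchurGeneral T5BergmanSchurPolarized T5BergmanGodement T5BergmanU11
  T5BergmanSchurGeneralU11 T5BergmanIntegrableKFinite T5BergmanCoefficientLp
  T5BergmanIntegrableSharpU11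
open scoped Real

/-! ### The centre acts by the central character on the coefficients of `U(1,1)` -/

/-- `scalarHom λ` commutes with every `g ∈ U(1,1)`. -/
lemma scalarHom_mul_comm (lam : Circle) (g : U11) : scalarHom lam * g = g * scalarHom lam :=
  (Subgroup.mem_center_iff.mp (scalarHom_mem_center lam) g).symm

/-- `⟨π_k(λ g) f, h⟩_k = λ^k ⟨π_k(g) f, h⟩_k` for every `g ∈ U(1,1)` and `λ ∈ Z`. -/
theorem matrixCoeffU_scalarHom_mul (k : ℕ) (f h : ℂ → ℂ) (lam : Circle) (g : U11) :
    matrixCoeffU k f h (scalarHom lam * g) = (lam : ℂ) ^ k * matrixCoeffU k f h g := by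
  obtain ⟨⟨mu, g'⟩, rfl⟩ := mulHom_surjective g
  have e : scalarHom lam * mulHom (mu, g') = mulHom (lam * mu, g') := by
    rw [mulHom_apply, mulHom_apply, map_mul, mul_assoc]
  rw [e, matrixCoeffU_mulHom, matrixCoeffU_mulHom, Circle.coe_mul, mul_pow, mul_assoc]

/-- `⟨π_k(g λ) f, h⟩_k = λ^k ⟨π_k(g) f, h⟩_k`. -/
theorem matrixCoeffU_mul_scalarHom (k : ℕ) (f h : ℂ → ℂ) (g : U11) (lam : Circle) :
    matrixCoeffU k f h (g * scalarHom lam) = (lam : ℂ) ^ k * matrixCoeffU k f h g := by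
  rw [← scalarHom_mul_comm, matrixCoeffU_scalarHom_mul]

/-- `(λ⁻¹)^k λ^k = 1` for `λ ∈ Circle`. -/
lemma coe_inv_pow_mul_pow (lam : Circle) (k : ℕ) :
    ((lam⁻¹ : Circle) : ℂ) ^ k * (lam : ℂ) ^ k = 1 := by
  rw [Circle.coe_inv, inv_pow, inv_mul_cancel₀ (pow_ne_zero k (Circle.coe_ne_zero lam))]

/-- **The convolution integrand is invariant under the centre**:
`⟨π_k(g (λ x)⁻¹) f, h⟩_k ⟨π_k(λ x) f', h'⟩_k = ⟨π_k(g x⁻¹) f, h⟩_k ⟨π_k(x) f', h'⟩_k`. -/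
theorem conv_integrand_scalarHom_mul (k : ℕ) (f h f' h' : ℂ → ℂ) (g : U11) (lam : Circle)
    (x : U11) :
    matrixCoeffU k f h (g * (scalarHom lam * x)⁻¹) * matrixCoeffU k f' h' (scalarHom lam * x) =
      matrixCoeffU k f h (g * x⁻¹) * matrixCoeffU k f' h' x := by
  have e : g * (scalarHom lam * x)⁻¹ = scalarHom lam⁻¹ * (g * x⁻¹) := by
    rw [mul_inv_rev, ← map_inv, ← mul_assoc, ← scalarHom_mul_comm]
  rw [e, matrixCoeffU_scalarHom_mul, matrixCoeffU_scalarHom_mul]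
  calc ((lam⁻¹ : Circle) : ℂ) ^ k * matrixCoeffU k f h (g * x⁻¹) *
        ((lam : ℂ) ^ k * matrixCoeffU k f' h' x)
      = (((lam⁻¹ : Circle) : ℂ) ^ k * (lam : ℂ) ^ k) *
          (matrixCoeffU k f h (g * x⁻¹) * matrixCoeffU k f' h' x) := by ring
    _ = _ := by rw [coe_inv_pow_mul_pow, one_mul]

/-- The convolution integrand pulled back to `SU(1,1)` along `incl`, for `g = mulHom (λ, g_S)`:
`λ^k ⟨π_k(g_S y⁻¹) f, h⟩_k ⟨π_k(y) f', h'⟩_k`. -/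
lemma conv_integrand_incl (k : ℕ) (f h f' h' : ℂ → ℂ) (lam : Circle) (gS y : SU11) :
    matrixCoeffU k f h (mulHom (lam, gS) * (incl y)⁻¹) * matrixCoeffU k f' h' (incl y) =
      (lam : ℂ) ^ k * (matrixCoeff k f h (gS * y⁻¹) * matrixCoeff k f' h' y) := by
  have e : mulHom (lam, gS) * (incl y)⁻¹ = mulHom (lam, gS * y⁻¹) := by
    rw [mulHom_apply, mulHom_apply, map_mul, map_inv, mul_assoc]
  rw [e, matrixCoeffU_mulHom, matrixCoeffU_incl, mul_assoc]

/-! ### Integrability of the convolution integrand -/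

/-- The complex conjugate of an integrable function is integrable. -/
lemma integrable_conj {α : Type*} [MeasurableSpace α] {μ : Measure α} {φ : α → ℂ}
    (hφ : Integrable φ μ) : Integrable (fun x => (starRingEnd ℂ) (φ x)) μ :=
  hφ.norm.mono' (Complex.continuous_conj.comp_aestronglyMeasurable hφ.aestronglyMeasurable)
    (Eventually.of_forall fun x => (Complex.norm_conj (φ x)).le)

/-- The convolution integrand is continuous on `U(1,1)`. -/
theorem continuous_conv_integrand (k : ℕ) (hk : 2 ≤ k) (f h f' h' : ℂ → ℂ)
    (hf : DifferentiableOn ℂ f (ball 0 1))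
    (hfint : IntegrableOn (fun w => ‖f w‖ ^ 2 * (1 - ‖w‖ ^ 2) ^ (k - 2)) (ball (0 : ℂ) 1))
    (hh : DifferentiableOn ℂ h (ball 0 1))
    (hhint : IntegrableOn (fun w => ‖h w‖ ^ 2 * (1 - ‖w‖ ^ 2) ^ (k - 2)) (ball (0 : ℂ) 1))
    (hf' : DifferentiableOn ℂ f' (ball 0 1))
    (hf'int : IntegrableOn (fun w => ‖f' w‖ ^ 2 * (1 - ‖w‖ ^ 2) ^ (k - 2)) (ball (0 : ℂ) 1))
    (hh' : DifferentiableOn ℂ h' (ball 0 1))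
    (hh'int : IntegrableOn (fun w => ‖h' w‖ ^ 2 * (1 - ‖w‖ ^ 2) ^ (k - 2)) (ball (0 : ℂ) 1))
    (g : U11) :
    Continuous fun x : U11 => matrixCoeffU k f h (g * x⁻¹) * matrixCoeffU k f' h' x :=
  ((continuous_matrixCoeffU_of_differentiableOn k hk f hf hfint h hh hhint).comp
    (continuous_const.mul continuous_inv)).mul
    (continuous_matrixCoeffU_of_differentiableOn k hk f' hf' hf'int h' hh' hh'int)

variable [MeasurableSpace Circle] [BorelSpace Circle]

/-- **Integrability on `SU(1,1)`**: `x ↦ ⟨π_k(g x⁻¹) f, h⟩_k ⟨π_k(x) f', h'⟩_k ∈ L¹(μ_R)` for holomorphic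
`f, h, f', h' ∈ A_k` (the conjugate of the product `⟨π_k(x) π_k(g⁻¹) h, f⟩_k · conj ⟨π_k(x) f', h'⟩_k`
of the Schur relations). -/
theorem integrable_matrixCoeff_mul_inv_mul (k : ℕ) (hk : 2 ≤ k) (f h f' h' : ℂ → ℂ)
    (hf : DifferentiableOn ℂ f (ball 0 1))
    (hfint : IntegrableOn (fun w => ‖f w‖ ^ 2 * (1 - ‖w‖ ^ 2) ^ (k - 2)) (ball (0 : ℂ) 1))
    (hh : DifferentiableOn ℂ h (ball 0 1))
    (hhint : IntegrableOn (fun w => ‖h w‖ ^ 2 * (1 - ‖w‖ ^ 2) ^ (k - 2)) (ball (0 : ℂ) 1))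
    (hf' : DifferentiableOn ℂ f' (ball 0 1))
    (hf'int : IntegrableOn (fun w => ‖f' w‖ ^ 2 * (1 - ‖w‖ ^ 2) ^ (k - 2)) (ball (0 : ℂ) 1))
    (hh' : DifferentiableOn ℂ h' (ball 0 1))
    (hh'int : IntegrableOn (fun w => ‖h' w‖ ^ 2 * (1 - ‖w‖ ^ 2) ^ (k - 2)) (ball (0 : ℂ) 1))
    (g : SU11) :
    Integrable (fun x => matrixCoeff k f h (g * x⁻¹) * matrixCoeff k f' h' x) ruhl := by
  have hH : DifferentiableOn ℂ (act k g⁻¹ h) (ball 0 1) := differentiableOn_act k g⁻¹ h hh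
  have hHint := integrableOn_act k hk g⁻¹ h hh hhint
  have hint := integrable_matrixCoeff_mul_conj k hk (act k g⁻¹ h) f f' h' hH hHint hf hfint hf'
    hf'int hh' hh'int
  have e : (fun x => matrixCoeff k f h (g * x⁻¹) * matrixCoeff k f' h' x) = fun x =>
      (starRingEnd ℂ) (matrixCoeff k (act k g⁻¹ h) f x * (starRingEnd ℂ) (matrixCoeff k f' h' x)) := by
    ext x
    rw [matrixCoeff_mul_inv k hk f h g x, map_mul, Complex.conj_conj]
  rw [e]
  exact integrable_conj hint

variable [MeasurableSpace U11] [BorelSpace U11]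

/-- **Integrability on `U(1,1)`**: `x ↦ ⟨π_k(g x⁻¹) f, h⟩_k ⟨π_k(x) f', h'⟩_k ∈ L¹(U(1,1), μ_U)` for every
Haar measure `μ_U` (the transfer principle of `T5BergmanIntegrableSharpU11`). -/
theorem integrable_conv_integrandU (μU : Measure U11) [IsHaarMeasure μU] (k : ℕ) (hk : 2 ≤ k)
    (f h f' h' : ℂ → ℂ) (hf : DifferentiableOn ℂ f (ball 0 1))
    (hfint : IntegrableOn (fun w => ‖f w‖ ^ 2 * (1 - ‖w‖ ^ 2) ^ (k - 2)) (ball (0 : ℂ) 1))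
    (hh : DifferentiableOn ℂ h (ball 0 1))
    (hhint : IntegrableOn (fun w => ‖h w‖ ^ 2 * (1 - ‖w‖ ^ 2) ^ (k - 2)) (ball (0 : ℂ) 1))
    (hf' : DifferentiableOn ℂ f' (ball 0 1))
    (hf'int : IntegrableOn (fun w => ‖f' w‖ ^ 2 * (1 - ‖w‖ ^ 2) ^ (k - 2)) (ball (0 : ℂ) 1))
    (hh' : DifferentiableOn ℂ h' (ball 0 1))
    (hh'int : IntegrableOn (fun w => ‖h' w‖ ^ 2 * (1 - ‖w‖ ^ 2) ^ (k - 2)) (ball (0 : ℂ) 1))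
    (g : U11) :
    Integrable (fun x : U11 => matrixCoeffU k f h (g * x⁻¹) * matrixCoeffU k f' h' x) μU := by
  obtain ⟨⟨lam, gS⟩, rfl⟩ := mulHom_surjective g
  rw [integrable_iff_of_mulHom μU ruhl
    (continuous_conv_integrand k hk f h f' h' hf hfint hh hhint hf' hf'int hh' hh'int _)
    (G := fun y => (lam : ℂ) ^ k * (matrixCoeff k f h (gS * y⁻¹) * matrixCoeff k f' h' y)) ?_]
  · exact (integrable_matrixCoeff_mul_inv_mul k hk f h f' h' hf hfint hh hhint hf' hf'int hh' hh'int
      gS).const_mul _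
  · intro mu y
    rw [mulHom_apply (mu, y), conv_integrand_scalarHom_mul, conv_integrand_incl]

/-! ### The convolution identity on `U(1,1)` -/

/-- **Godement's convolution identity on `H_j = U(1,1)`**: for holomorphic `f, h, f', h' ∈ A_k`, `k ≥ 2`,
every Haar measure `μ_U` of `U(1,1)` and every `g ∈ U(1,1)`,
`c_U • ∫_{U(1,1)} ⟨π_k(g x⁻¹) f, h⟩_k ⟨π_k(x) f', h'⟩_k dμ_U(x) = ⟨f, h'⟩_k ⟨π_k(g) f', h⟩_k / (k - 1)`,
`c_U = haarScalarFactor (map mulHom (haarCircle ⊗ μ_R)) μ_U > 0`. -/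
theorem integral_matrixCoeffU_mul_inv_mul (μU : Measure U11) [IsHaarMeasure μU] (k : ℕ) (hk : 2 ≤ k)
    (f h f' h' : ℂ → ℂ) (hf : DifferentiableOn ℂ f (ball 0 1))
    (hfint : IntegrableOn (fun w => ‖f w‖ ^ 2 * (1 - ‖w‖ ^ 2) ^ (k - 2)) (ball (0 : ℂ) 1))
    (hh : DifferentiableOn ℂ h (ball 0 1))
    (hhint : IntegrableOn (fun w => ‖h w‖ ^ 2 * (1 - ‖w‖ ^ 2) ^ (k - 2)) (ball (0 : ℂ) 1))
    (hf' : DifferentiableOn ℂ f' (ball 0 1))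
    (hf'int : IntegrableOn (fun w => ‖f' w‖ ^ 2 * (1 - ‖w‖ ^ 2) ^ (k - 2)) (ball (0 : ℂ) 1))
    (hh' : DifferentiableOn ℂ h' (ball 0 1))
    (hh'int : IntegrableOn (fun w => ‖h' w‖ ^ 2 * (1 - ‖w‖ ^ 2) ^ (k - 2)) (ball (0 : ℂ) 1))
    (g : U11) :
    (haarScalarFactor (map mulHom (haarCircle.prod ruhl)) μU : ℝ) •
      ∫ x, matrixCoeffU k f h (g * x⁻¹) * matrixCoeffU k f' h' x ∂μU =
      pairing k f h' * matrixCoeffU k f' h g / ((k : ℂ) - 1) := by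
  rw [integral_eq_of_scalar_invariant haarCircle ruhl μU _
    (integrable_conv_integrandU μU k hk f h f' h' hf hfint hh hhint hf' hf'int hh' hh'int g)
    (fun lam x => conv_integrand_scalarHom_mul k f h f' h' g lam x), haarCircle_univ,
    ENNReal.toReal_one, one_smul]
  obtain ⟨⟨lam, gS⟩, rfl⟩ := mulHom_surjective g
  simp_rw [conv_integrand_incl k f h f' h' lam gS]
  rw [integral_const_mul, integral_matrixCoeff_mul_inv_mul k hk f h f' h' hf hfint hh hhint hf'
    hf'int hh' hh'int gS, matrixCoeffU_mulHom]
  ring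

/-- **Godement's idempotent relation on `U(1,1)`** for `φ_v(g) = ⟨π_k(g) v, v⟩_k`:
`c_U • ∫_{U(1,1)} φ_v(g x⁻¹) φ_v(x) dμ_U(x) = (⟨v, v⟩_k / (k - 1)) · φ_v(g)`. -/
theorem godementU (μU : Measure U11) [IsHaarMeasure μU] (k : ℕ) (hk : 2 ≤ k) (v : ℂ → ℂ)
    (hv : DifferentiableOn ℂ v (ball 0 1))
    (hvint : IntegrableOn (fun w => ‖v w‖ ^ 2 * (1 - ‖w‖ ^ 2) ^ (k - 2)) (ball (0 : ℂ) 1))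
    (g : U11) :
    (haarScalarFactor (map mulHom (haarCircle.prod ruhl)) μU : ℝ) •
      ∫ x, matrixCoeffU k v v (g * x⁻¹) * matrixCoeffU k v v x ∂μU =
      pairing k v v / ((k : ℂ) - 1) * matrixCoeffU k v v g := by
  rw [integral_matrixCoeffU_mul_inv_mul μU k hk v v v v hv hvint hv hvint hv hvint hv hvint g]
  ring

/-- The normalised coefficient `d_U · φ_v`, `d_U = c_U (k-1)/⟨v,v⟩_k`, is a convolution idempotent of
`L¹(U(1,1), μ_U)` (`⟨v,v⟩_k ≠ 0`). -/
theorem godement_normalizedU (μU : Measure U11) [IsHaarMeasure μU] (k : ℕ) (hk : 2 ≤ k)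
    (v : ℂ → ℂ) (hv : DifferentiableOn ℂ v (ball 0 1))
    (hvint : IntegrableOn (fun w => ‖v w‖ ^ 2 * (1 - ‖w‖ ^ 2) ^ (k - 2)) (ball (0 : ℂ) 1))
    (hv0 : pairing k v v ≠ 0) (g : U11) :
    ∫ x, (((haarScalarFactor (map mulHom (haarCircle.prod ruhl)) μU : ℝ) : ℂ) * ((k : ℂ) - 1) /
          pairing k v v * matrixCoeffU k v v (g * x⁻¹)) *
        (((haarScalarFactor (map mulHom (haarCircle.prod ruhl)) μU : ℝ) : ℂ) * ((k : ℂ) - 1) /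
          pairing k v v * matrixCoeffU k v v x) ∂μU =
      ((haarScalarFactor (map mulHom (haarCircle.prod ruhl)) μU : ℝ) : ℂ) * ((k : ℂ) - 1) /
        pairing k v v * matrixCoeffU k v v g := by
  set c : NNReal := haarScalarFactor (map mulHom (haarCircle.prod ruhl)) μU with hc
  have hc0 : (c : ℝ) ≠ 0 := by
    exact_mod_cast (T5U11Product.haarScalarFactor_pos haarCircle ruhl μU).ne'
  have hc0' : ((c : ℝ) : ℂ) ≠ 0 := by exact_mod_cast hc0
  have hk1 : ((k : ℂ) - 1) ≠ 0 := by
    have : (2 : ℝ) ≤ k := by exact_mod_cast hk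
    have h2 : ((k : ℝ) - 1) ≠ 0 := by linarith
    exact_mod_cast h2
  have hG := godementU μU k hk v hv hvint g
  rw [← hc, Complex.real_smul] at hG
  have hI : ∫ x, matrixCoeffU k v v (g * x⁻¹) * matrixCoeffU k v v x ∂μU =
      pairing k v v / ((k : ℂ) - 1) * matrixCoeffU k v v g / ((c : ℝ) : ℂ) := by
    rw [← hG]
    field_simp
  have e : ∀ x : U11, (((c : ℝ) : ℂ) * ((k : ℂ) - 1) / pairing k v v * matrixCoeffU k v v (g * x⁻¹)) *
      (((c : ℝ) : ℂ) * ((k : ℂ) - 1) / pairing k v v * matrixCoeffU k v v x) =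
      (((c : ℝ) : ℂ) * ((k : ℂ) - 1) / pairing k v v) ^ 2 *
        (matrixCoeffU k v v (g * x⁻¹) * matrixCoeffU k v v x) := by
    intro x
    ring
  simp_rw [e]
  rw [integral_const_mul, hI]
  field_simp

/-- Godement's relation on `U(1,1)` for the lowest-weight vector (`⟨1,1⟩_k = π/(k-1)`):
`c_U • ∫_{U(1,1)} ⟨π_k(g x⁻¹) 1, 1⟩_k ⟨π_k(x) 1, 1⟩_k dμ_U(x) = (π/(k-1)²) ⟨π_k(g) 1, 1⟩_k`. -/
theorem godement_lowestU (μU : Measure U11) [IsHaarMeasure μU] (k : ℕ) (hk : 2 ≤ k) (g : U11) :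
    (haarScalarFactor (map mulHom (haarCircle.prod ruhl)) μU : ℝ) •
      ∫ x, matrixCoeffU k lowest lowest (g * x⁻¹) * matrixCoeffU k lowest lowest x ∂μU =
      ((π / ((k : ℝ) - 1) ^ 2 : ℝ) : ℂ) * matrixCoeffU k lowest lowest g := by
  rw [godementU μU k hk lowest (differentiableOn_const 1) (integrableOn_lowest k) g,
    pairing_lowest_lowest k hk]
  congr 1
  have hk1 : ((k : ℂ) - 1) ≠ 0 := by
    have : (2 : ℝ) ≤ k := by exact_mod_cast hk
    have h2 : ((k : ℝ) - 1) ≠ 0 := by linarith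
    exact_mod_cast h2
  push_cast
  field_simp

end Summit.Ventures.HodgeRepro2.T5BergmanGodementU11
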